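import Summits.ResolutionOfSingularities.ResolutionOfSingularities.Theorems.HomologicalConductorNoZenoSpecResidueField
import Literature.AlgebraicGeometry.Resolution.Lipman1969RationalContractionRegime
import Literature.AlgebraicGeometry.Resolution.ExceptionalCurveDegree
import Literature.AlgebraicGeometry.Motives.SubschemeCyclesPushPullProofs
import Literature.AlgebraicGeometry.Motives.SubschemeCyclesDimProofs
import Literature.AlgebraicGeometry.Motives.CartierDivisorIntersectionCycle
import HarnessLib

/-!
# Crux `NoZenoR` (stmt-ResolutionOfSingularities-19943), β layer — LEMMA H (slot 5, UP-6):
# `h⁰(𝒪_{E_η}) ≤ [κ(x) : κ(𝔪)]` at every closed point `x` of an integral exceptional curve `E_η`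

Route `ResolutionOfSingularities/HomologicalConductor`, crux chain W4.4.  OURS (cell res-hironaka; planner res-L0-w44-plan-1 DESK
WORD 7 (b) «LEMMA H», offered as (o-H); consumer res-L0-w44-stub-3 (o-UP6) `…NoZenoIncidenceGraphAcyclic`, where it replaces the
printed divisibility F-97a by the one-point bound the telescoping needs); AI-written, weaker than expert review; nothing of the
manuscript under review (Hironaka 2017) is used and no Theses declaration is asserted.  Def-free, `--supports 19943 --as helper`.

For `π : X → Spec S` proper (`S` Noetherian local), `η ∈ excCurvePoints π`, `E_η = ClosedSubvariety.ofPoint X η` (= `V(primeDivisorIdeal η)`,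
`subschemeι_primeDivisorIdeal`) and a point `y` of `E_η` with FINITE residue extension `κ(y)/κ(𝔪)` (every point other than the
generic point — `residueDegree_ofPoint_ne_zero`):

* `h0_primeDivisorIdeal_le_residueDegree` — **`h0 π (primeDivisorIdeal η) ≤ [κ(y) : κ(𝔪)]`** (in `ℕ∞`; `…toNat_le…` in `ℕ`);
  spelling (ii) `…_base`: `≤ π.residueDegree x` for the point `x` of `X` (bridge `residueDegree_ofPointPt_eq`).

Proof.  `Γ := Γ(E_η, 𝒪)` is a domain (integral scheme), module-finite over `S` (`moduleFinite_sections_top_of_isProper`) and killed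
by `𝔪` (`appTop_ΓSpecIso_inv_eq_zero_of_mem_maximalIdeal`), hence a finite-dimensional `κ(𝔪)`-algebra which is a domain, i.e. a
FIELD `k_η` (`Algebra.IsIntegral.isField_iff_isField`), and `h0 = length_S Γ = dim_κ Γ` (`Module.length_eq_of_surjective`,
`Module.length_eq_finrank`).  The evaluation `Γ → κ(y)` is an `S`-linear ring map out of a field, so injective, whence
`length_S Γ ≤ length_S κ(y) = [κ(y) : κ(𝔪)]` (`Module.length_le_of_injective`; `S → κ(𝔪) = κ(closed point of Spec S)` is onto,
`ΓtoResidueField_surjective_of_isMaximal`).  (Lipman 1969 §10 p. 212: `h⁰(C) = λ_A H⁰(C, 𝒪_C)`; for an integral `C` this is the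
degree of the field of constants `H⁰(𝒪_C)` over `κ(𝔪)`, which embeds in every residue field of a closed point — context.)

References: J. Lipman, Publ. Math. IHÉS 36 (1969) §10 (p. 212), §12 Remark 2 a) (p. 221) [`Lipman1969`] (context).
-/

-- single-problem summit: the doubled namespace component `ResolutionOfSingularities` is forced
set_option linter.dupNamespace false

noncomputable section

namespace Summit.ResolutionOfSingularities.ResolutionOfSingularities.Theorems.NoZeno.ExcCount

open CategoryTheory AlgebraicGeometry TopologicalSpace IsLocalRing Opposite
open Literature.AlgebraicGeometry.Resolution Literature.AlgebraicGeometry.Motives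
open Literature.AlgebraicGeometry.Morphisms

variable {S : Type} [CommRing S] [IsLocalRing S] {X : Scheme.{0}} (π : X ⟶ Spec (.of S))

/-- `V(primeDivisorIdeal η)` IS the integral curve `ClosedSubvariety.ofPoint X η` (both are the reduced closed subscheme on
`closure {η}`): the two closed immersions agree (`rfl`). [folklore] -/
theorem subschemeι_primeDivisorIdeal (η : X) :
    (primeDivisorIdeal η).subschemeι = (ClosedSubvariety.ofPoint X η).ι :=
  rfl

omit [IsLocalRing S] in
/-- `h0 π (primeDivisorIdeal η)` is the `S`-length of the global sections of the integral curve `E_η = ClosedSubvariety.ofPoint X η`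
(`rfl`). [cite: Lipman1969, Section 10 (p. 212)] -/
theorem h0_primeDivisorIdeal_eq (η : X) :
    h0 π (primeDivisorIdeal η) = Module.length S (Sections ((ClosedSubvariety.ofPoint X η).ι ≫ π) ⊤) :=
  rfl

omit [IsLocalRing S] in
/-- The structure map `S → Γ(E_η, 𝒪)` of the sections module is `π♯ ∘ ι♯` on `Γ`: `algebraMap S Γ s = (ι ≫ π).appTop (ΓSpecIso⁻¹ s)`.
[folklore] -/
theorem algebraMap_sections_ofPoint_apply (η : X) (s : S) :
    algebraMap S (Sections ((ClosedSubvariety.ofPoint X η).ι ≫ π) ⊤) s =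
      ((ClosedSubvariety.ofPoint X η).ι ≫ π).appTop ((Scheme.ΓSpecIso (.of S)).inv s) := by
  rw [Sections.algebraMap_apply]
  have : (homOfLE (le_top : (⊤ : (ClosedSubvariety.ofPoint X η).carrier.Opens) ≤ ⊤)).op = 𝟙 _ :=
    Subsingleton.elim _ _
  rw [this, (ClosedSubvariety.ofPoint X η).carrier.presheaf.map_id]
  rfl

/-- **`𝔪` kills `Γ(E_η, 𝒪)`** for `η` over the closed point (tree `appTop_ΓSpecIso_inv_eq_zero_of_mem_maximalIdeal`).
[cite: Lipman1969, Section 12 (p. 220)] -/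
theorem algebraMap_sections_ofPoint_eq_zero {η : X} (hη : π η = closedPoint S) {s : S}
    (hs : s ∈ maximalIdeal S) : algebraMap S (Sections ((ClosedSubvariety.ofPoint X η).ι ≫ π) ⊤) s = 0 := by
  rw [algebraMap_sections_ofPoint_apply]
  exact appTop_ΓSpecIso_inv_eq_zero_of_mem_maximalIdeal π hη hs

variable [IsNoetherianRing S]

/-- **LEMMA H**: for `π : X → Spec S` proper (`S` Noetherian local), `η ∈ excCurvePoints π` and a point `y` of the integral curve
`E_η = ClosedSubvariety.ofPoint X η` whose residue field is finite over `κ(𝔪)` (`residueDegree ≠ 0`; e.g. any non-generic point,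
`residueDegree_ofPoint_ne_zero`), **`h0 π (primeDivisorIdeal η) ≤ [κ(y) : κ(𝔪)]`**: the field of constants `Γ(E_η, 𝒪)` (a domain,
finite over `κ(𝔪)`, hence a field, of `κ(𝔪)`-dimension `h0`) embeds `κ(𝔪)`-linearly into `κ(y)` by evaluation.
[cite: Lipman1969, Section 10 (p. 212)] -/
theorem h0_primeDivisorIdeal_le_residueDegree [IsProper π] {η : X} (hη : η ∈ excCurvePoints π)
    (y : (ClosedSubvariety.ofPoint X η).carrier) (hy : ((ClosedSubvariety.ofPoint X η).ι ≫ π).residueDegree y ≠ 0) :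
    h0 π (primeDivisorIdeal η) ≤ ((ClosedSubvariety.ofPoint X η).ι ≫ π).residueDegree y := by
  rw [h0_primeDivisorIdeal_eq]
  haveI : Module.Finite S (Sections ((ClosedSubvariety.ofPoint X η).ι ≫ π) ⊤) :=
    moduleFinite_sections_top_of_isProper _
  haveI : IsDomain (Sections ((ClosedSubvariety.ofPoint X η).ι ≫ π) ⊤) :=
    inferInstanceAs (IsDomain Γ((ClosedSubvariety.ofPoint X η).carrier, ⊤))
  -- the `κ(𝔪)`-algebra structure on `Γ := Γ(E_η, 𝒪)`
  have hkill : ∀ s ∈ maximalIdeal S, algebraMap S (Sections ((ClosedSubvariety.ofPoint X η).ι ≫ π) ⊤) s = 0 :=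
    fun s hs => algebraMap_sections_ofPoint_eq_zero π hη.1 hs
  letI algK : Algebra (ResidueField S) (Sections ((ClosedSubvariety.ofPoint X η).ι ≫ π) ⊤) :=
    (Ideal.Quotient.lift (maximalIdeal S) (algebraMap S _) hkill).toAlgebra
  haveI : IsScalarTower S (ResidueField S) (Sections ((ClosedSubvariety.ofPoint X η).ι ≫ π) ⊤) :=
    IsScalarTower.of_algebraMap_eq fun s => (Ideal.Quotient.lift_mk (maximalIdeal S) _ hkill).symm
  haveI : Module.Finite (ResidueField S) (Sections ((ClosedSubvariety.ofPoint X η).ι ≫ π) ⊤) :=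
    Module.Finite.of_restrictScalars_finite S _ _
  -- `Γ` is a field
  have hΓ : IsField (Sections ((ClosedSubvariety.ofPoint X η).ι ≫ π) ⊤) :=
    (Algebra.IsIntegral.isField_iff_isField (R := ResidueField S)
      (algebraMap (ResidueField S) (Sections ((ClosedSubvariety.ofPoint X η).ι ≫ π) ⊤)).injective).mp
      (Field.toIsField _)
  -- `length_S Γ = dim_κ Γ`
  have hlenΓ : Module.length S (Sections ((ClosedSubvariety.ofPoint X η).ι ≫ π) ⊤) =
      Module.finrank (ResidueField S) (Sections ((ClosedSubvariety.ofPoint X η).ι ≫ π) ⊤) := by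
    rw [Module.length_eq_of_surjective (S := S) (R := ResidueField S) (IsLocalRing.residue_surjective),
      Module.length_eq_finrank]
  -- the residue field `L = κ(y)` as an `S`-module through `S → κ(g y) → κ(y)`, `g = ι ≫ π`
  set g : (ClosedSubvariety.ofPoint X η).carrier ⟶ Spec (.of S) := (ClosedSubvariety.ofPoint X η).ι ≫ π with hg
  have hgy : g y = closedPoint S :=
    base_eq_closedPoint_of_specializes π hη.1 (ClosedSubvariety.specializes_ofPoint_ι η y)
  haveI : (g y).asIdeal.IsMaximal := by
    rw [hgy]; exact IsLocalRing.maximalIdeal.isMaximal S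
  let φ₀ : S →+* (Spec (.of S)).residueField (g y) :=
    ((Scheme.ΓSpecIso (.of S)).inv ≫ (Spec (.of S)).Γevaluation (g y)).hom
  have hφ₀ : Function.Surjective φ₀ := ΓtoResidueField_surjective_of_isMaximal S (g y)
  letI algSK : Algebra S ((Spec (.of S)).residueField (g y)) := φ₀.toAlgebra
  letI algKL : Algebra ((Spec (.of S)).residueField (g y)) ((ClosedSubvariety.ofPoint X η).carrier.residueField y) :=
    (g.residueFieldMap y).hom.toAlgebra
  letI algSL : Algebra S ((ClosedSubvariety.ofPoint X η).carrier.residueField y) :=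
    ((g.residueFieldMap y).hom.comp φ₀).toAlgebra
  haveI : IsScalarTower S ((Spec (.of S)).residueField (g y)) ((ClosedSubvariety.ofPoint X η).carrier.residueField y) :=
    IsScalarTower.of_algebraMap_eq fun _ => rfl
  have hdeg : g.residueDegree y =
      Module.finrank ((Spec (.of S)).residueField (g y)) ((ClosedSubvariety.ofPoint X η).carrier.residueField y) := rfl
  haveI : Module.Finite ((Spec (.of S)).residueField (g y)) ((ClosedSubvariety.ofPoint X η).carrier.residueField y) :=
    Module.finite_of_finrank_pos (Nat.pos_of_ne_zero (hdeg ▸ hy))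
  have hlenL : Module.length S ((ClosedSubvariety.ofPoint X η).carrier.residueField y) = (g.residueDegree y : ℕ∞) := by
    rw [Module.length_eq_of_surjective (S := S) (R := (Spec (.of S)).residueField (g y)) hφ₀,
      Module.length_eq_finrank, hdeg]
  -- the evaluation `Γ → κ(y)` is `S`-linear …
  have hcompat : ∀ s : S,
      ((ClosedSubvariety.ofPoint X η).carrier.Γevaluation y).hom
          (algebraMap S (Sections ((ClosedSubvariety.ofPoint X η).ι ≫ π) ⊤) s) =
        algebraMap S ((ClosedSubvariety.ofPoint X η).carrier.residueField y) s := by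
    intro s
    rw [algebraMap_sections_ofPoint_apply]
    exact (Scheme.Γevaluation_naturality_apply g y ((Scheme.ΓSpecIso (.of S)).inv s)).symm
  -- (as a ring map on the type synonym `Sections`, so that `map_mul` sees the right multiplication)
  let evR : Sections ((ClosedSubvariety.ofPoint X η).ι ≫ π) ⊤ →+* ((ClosedSubvariety.ofPoint X η).carrier.residueField y) :=
    ((ClosedSubvariety.ofPoint X η).carrier.Γevaluation y).hom.comp
      (Sections.equiv ((ClosedSubvariety.ofPoint X η).ι ≫ π) ⊤).toRingHom
  have hevR : ∀ γ, evR γ = ((ClosedSubvariety.ofPoint X η).carrier.Γevaluation y).hom γ := fun _ => rfl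
  let ev : Sections ((ClosedSubvariety.ofPoint X η).ι ≫ π) ⊤ →ₗ[S] ((ClosedSubvariety.ofPoint X η).carrier.residueField y) :=
    { toFun := evR
      map_add' := fun a b => map_add evR a b
      map_smul' := fun s γ => by
        change evR (s • γ) = s • evR γ
        rw [Algebra.smul_def, map_mul, hevR (algebraMap S _ s), hcompat, Algebra.smul_def] }
  -- … and injective (a ring map out of a field)
  have hinj : Function.Injective ev := by
    rw [injective_iff_map_eq_zero]
    intro γ hγ
    by_contra hne
    obtain ⟨δ, hδ⟩ := hΓ.mul_inv_cancel hne
    have h1 : evR (γ * δ) = 0 := by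
      rw [map_mul]
      change ev γ * _ = 0
      rw [hγ, zero_mul]
    rw [hδ, map_one] at h1
    exact one_ne_zero h1
  calc Module.length S (Sections ((ClosedSubvariety.ofPoint X η).ι ≫ π) ⊤)
      ≤ Module.length S ((ClosedSubvariety.ofPoint X η).carrier.residueField y) := Module.length_le_of_injective ev hinj
    _ = (g.residueDegree y : ℕ∞) := hlenL

/-- LEMMA H in `ℕ`: `(h0 π (primeDivisorIdeal η)).toNat ≤ [κ(y) : κ(𝔪)]`. [cite: Lipman1969, Section 10 (p. 212)] -/
theorem h0_primeDivisorIdeal_toNat_le_residueDegree [IsProper π] {η : X} (hη : η ∈ excCurvePoints π)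
    (y : (ClosedSubvariety.ofPoint X η).carrier) (hy : ((ClosedSubvariety.ofPoint X η).ι ≫ π).residueDegree y ≠ 0) :
    (h0 π (primeDivisorIdeal η)).toNat ≤ ((ClosedSubvariety.ofPoint X η).ι ≫ π).residueDegree y :=
  ENat.toNat_le_of_le_coe (h0_primeDivisorIdeal_le_residueDegree π hη y hy)

omit [IsNoetherianRing S] in
/-- **Every non-generic point of an integral exceptional curve has finite residue field over `κ(𝔪)`**: for `y` in
`E_η = ClosedSubvariety.ofPoint X η` over `x ≠ η`, `[κ(y) : κ(𝔪)] ≠ 0` — `E_η` is of finite type over the FIELD `κ(𝔪)`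
(`exists_fac_specResidueField`), `y` is a closed point of it (height `0`: below the generic point of the one-dimensional `E_η`), and
closed points of a scheme of finite type over a field have finite residue extensions (Zariski's lemma, tree
`residueDegree_ne_zero_of_height_asFiber_eq_zero`). [folklore] -/
theorem residueDegree_ofPoint_ne_zero [IsProper π] {η : X} (hη : η ∈ excCurvePoints π)
    (y : (ClosedSubvariety.ofPoint X η).carrier) (hy : (ClosedSubvariety.ofPoint X η).ι y ≠ η) :
    ((ClosedSubvariety.ofPoint X η).ι ≫ π).residueDegree y ≠ 0 := by
  obtain ⟨q, hq⟩ := exists_fac_specResidueField π hη.1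
  haveI : IsProper q := isProper_of_fac_specResidueField π hq
  rw [residueDegree_ι_comp_eq_of_fac π hq]
  refine residueDegree_ne_zero_of_height_asFiber_eq_zero q y ?_
  -- `height y = height (q y) + height (q.asFiber y)` over the field `κ(𝔪)`, and `height (q y) = 0`
  have h := Scheme.height_eq_height_add_height_asFiber q (𝟙 (Spec (.of (ResidueField S)))) y
  have hq0 : Order.height (q y) = 0 := by
    haveI : Subsingleton ↥(Spec (CommRingCat.of (ResidueField S))) :=
      inferInstanceAs (Subsingleton (PrimeSpectrum (ResidueField S)))
    rw [Order.height_eq_zero]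
    intro b _
    exact (Subsingleton.elim (q y) b).le
  -- `height y = 0`: `y` lies strictly below the generic point of the one-dimensional `E_η`
  have hy0 : Order.height y = 0 := by
    have hyt : y ≠ (⊤ : ↥(ClosedSubvariety.ofPoint X η).carrier) := fun hyt => hy (by
      rw [hyt]; exact ClosedSubvariety.genericPoint_ofPoint η)
    -- (the specialisation order of a scheme is only registered as a preorder: prove `y < ⊤` by hand)
    have hlt : y < (⊤ : ↥(ClosedSubvariety.ofPoint X η).carrier) :=
      lt_iff_le_not_ge.mpr ⟨le_top, fun h => hyt
        ((Scheme.le_iff_specializes.mp h).antisymm (Scheme.le_iff_specializes.mp (le_top (a := y)))).eq⟩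
    have htop : Order.height (⊤ : ↥(ClosedSubvariety.ofPoint X η).carrier) = 1 := by
      rw [height_top_ofPoint, hη.2]
    have h1 : Order.height y < Order.height (⊤ : ↥(ClosedSubvariety.ofPoint X η).carrier) :=
      Order.height_strictMono hlt (lt_of_le_of_lt (Order.height_mono hlt.le)
        (by rw [htop, ← Nat.cast_one]; exact ENat.coe_lt_top 1))
    rw [htop] at h1
    -- `height y < 1`
    by_contra h0
    exact (not_lt.mpr (Order.one_le_iff_ne_zero.mpr h0)) h1
  rw [hy0, hq0, zero_add] at h
  exact h.symm

/-- LEMMA H at a point given downstairs: for `x ∈ X` with `η ⤳ x`, `x ≠ η`, the point of `E_η` over `x`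
(`ClosedSubvariety.ofPointPt`) satisfies `(h0 π (primeDivisorIdeal η)).toNat ≤ [κ(x) : κ(𝔪)]` (residue degree of `E_η → Spec S` at
that point; `κ` of the point of `E_η` over `x` is `κ(x)`, `E_η → X` being a closed immersion). [cite: Lipman1969, Section 10 (p. 212)] -/
theorem h0_primeDivisorIdeal_toNat_le_residueDegree_ofPointPt [IsProper π] {η x : X} (hη : η ∈ excCurvePoints π)
    (hx : η ⤳ x) (hne : x ≠ η) :
    (h0 π (primeDivisorIdeal η)).toNat ≤
      ((ClosedSubvariety.ofPoint X η).ι ≫ π).residueDegree (ClosedSubvariety.ofPointPt η hx) :=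
  h0_primeDivisorIdeal_toNat_le_residueDegree π hη _
    (residueDegree_ofPoint_ne_zero π hη _ (by rw [ClosedSubvariety.ofPoint_ι_ofPointPt]; exact hne))

/-! ## Spelling (ii): the residue degree of the point of `X` (Mathlib `Scheme.Hom.residueDegree π x`) -/

omit [IsLocalRing S] [IsNoetherianRing S] in
/-- **Bridge of currencies**: the residue degree of the point of `E_η` over `x` along `E_η → X → Spec S` equals the residue degree
of `x` along `π : X → Spec S` — `E_η → X` is a closed immersion, so its residue degree at the point is `1`
(`residueDegree_eq_one_of_stalkMap_surjective`) and residue degrees multiply along compositions (`residueDegree_comp`). [folklore] -/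
theorem residueDegree_ofPointPt_eq {η x : X} (hx : η ⤳ x) :
    ((ClosedSubvariety.ofPoint X η).ι ≫ π).residueDegree (ClosedSubvariety.ofPointPt η hx) = π.residueDegree x := by
  rw [residueDegree_comp, residueDegree_eq_one_of_stalkMap_surjective (ClosedSubvariety.ofPoint X η).ι
    (ClosedSubvariety.ofPointPt η hx) (((ClosedSubvariety.ofPoint X η).ι).stalkMap_surjective _), one_mul]
  rfl

/-- **LEMMA H, spelling (ii)** (the joint currency proposed by res-D-pv-045 for (o-H2), STATUS 19:25:31Z): for `π : X → Spec S`
proper (`S` Noetherian local), `η ∈ excCurvePoints π`, `η ⤳ x`, `x ≠ η`: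
`(h0 π (primeDivisorIdeal η)).toNat ≤ π.residueDegree x` (Mathlib `Scheme.Hom.residueDegree`, `[κ(x) : κ(π x)]` through
`π.residueFieldMap x`). [cite: Lipman1969, Section 10 (p. 212)] -/
theorem h0_primeDivisorIdeal_toNat_le_residueDegree_base [IsProper π] {η x : X} (hη : η ∈ excCurvePoints π)
    (hx : η ⤳ x) (hne : x ≠ η) : (h0 π (primeDivisorIdeal η)).toNat ≤ π.residueDegree x := by
  rw [← residueDegree_ofPointPt_eq π hx]
  exact h0_primeDivisorIdeal_toNat_le_residueDegree_ofPointPt π hη hx hne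

/-- LEMMA H, spelling (ii), in `ℕ∞`: `h0 π (primeDivisorIdeal η) ≤ π.residueDegree x`. [cite: Lipman1969, Section 10 (p. 212)] -/
theorem h0_primeDivisorIdeal_le_residueDegree_base [IsProper π] {η x : X} (hη : η ∈ excCurvePoints π)
    (hx : η ⤳ x) (hne : x ≠ η) : h0 π (primeDivisorIdeal η) ≤ π.residueDegree x := by
  rw [← residueDegree_ofPointPt_eq π hx]
  exact h0_primeDivisorIdeal_le_residueDegree π hη _
    (residueDegree_ofPoint_ne_zero π hη _ (by rw [ClosedSubvariety.ofPoint_ι_ofPointPt]; exact hne))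

end Summit.ResolutionOfSingularities.ResolutionOfSingularities.Theorems.NoZeno.ExcCount

end
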